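import Literature.Analysis.Complex.HarmonicMaxPrinciple
import Mathlib.Analysis.InnerProductSpace.Harmonic.Constructions
import HarnessLib

/-!
# Lindelöf's maximum principle: finitely many exceptional boundary points

Topic `Literature/Analysis/Complex`, namespace `Literature.Analysis.Complex`; a complement to
`HarmonicMaxPrinciple.lean` (the weak maximum principle in lim-sup form,
`harmonic_le_of_frontier_of_cocompact`). T. Ransford, *Potential Theory in the Complex Plane*
(1995), Theorem 3.6.9 (Extended Maximum Principle): *let `D` be a domain and `u` a subharmonic
function on `D` which is bounded above; (b) if `∂D` is non-polar and `limsup_{z → ζ} u(z) ≤ 0`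
for nearly every `ζ ∈ ∂D`, then `u ≤ 0` on `D`.* We prove the special case that is Lindelöf's
classical maximum principle and the form in which it is used for boundary-value uniqueness with
finitely many marked boundary points (e.g. Smirnov 2010, proof of Lemma B.3, "being bounded
coincides with `h`"; the S18 road of `Probability/LatticeModels/Sweep1Proofs.lean`, §2b step B4):
`D ⊆ ℂ` open, preconnected and **bounded**, `u` **harmonic** on `D` (Mathlib's
`InnerProductSpace.HarmonicOnNhd`) and bounded above, the exceptional set `E` **finite** and
disjoint from `D` (finite sets are polar, and a bounded domain has non-polar boundary, so this is
inside case (b)). The proof is the elementary one by logarithmic poles, by induction on `E`: for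
`e ∈ E` and `ε' > 0` the harmonic function `u + ε' log(|z - e|/R)` (`R` larger than all the
distances involved, so the added term is `≤ 0` on `D`) tends to `-∞` at `e`, so the statement with
one exceptional point fewer applies to it, and `ε' → 0`.

* `harmonic_le_of_frontier_diff_finite` — `lim sup u ≤ M` at the boundary points off `E`
  implies `u ≤ M`;
* `harmonic_ge_of_frontier_diff_finite` — the minimum principle;
* `harmonic_eq_zero_of_tendsto_frontier_diff_finite` — a bounded harmonic function tending to `0`
  at every boundary point off a finite set vanishes (uniqueness of bounded solutions of the
  Dirichlet problem with finitely many discontinuities of the data).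

## References

* T. Ransford, *Potential Theory in the Complex Plane*, LMS Student Texts 28, CUP (1995),
  Thm. 3.6.9 (READ, p. 57 of the held text) [Ransford1995].
* J. B. Conway, *Functions of One Complex Variable I* (1978), Ch. X §1 [Conway1978].
-/

noncomputable section

open Set Filter Metric Topology Complex InnerProductSpace Bornology

namespace Literature.Analysis.Complex

/-- For bounded `U` the filter "at infinity inside `U`" is trivial, so the condition at `∞` of
`harmonic_le_of_frontier_of_cocompact` is vacuous. [folklore] -/
theorem eventually_cocompact_inf_principal_of_isBounded {U : Set ℂ} (hU : IsBounded U) (p : ℂ → Prop) :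
    ∀ᶠ z in cocompact ℂ ⊓ 𝓟 U, p z := by
  obtain ⟨r, hr⟩ := hU.subset_closedBall 0
  rw [Filter.eventually_inf_principal]
  filter_upwards [(isCompact_closedBall (0 : ℂ) r).compl_mem_cocompact] with z hz hzU
  exact absurd (hr hzU) hz

/-- `z ↦ log (‖z - e‖ / R)` is harmonic away from `e` (`R > 0`): it is `log ‖g‖` for the
zero-free analytic function `g(z) = (z - e)/R`. [folklore] -/
theorem harmonicOnNhd_log_norm_sub_div {U : Set ℂ} {e : ℂ} (he : e ∉ U) {R : ℝ} (hR : 0 < R) :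
    HarmonicOnNhd (fun z : ℂ ↦ Real.log (‖z - e‖ / R)) U := by
  intro z hz
  have hze : z ≠ e := fun h ↦ he (h ▸ hz)
  have e1 : (fun z : ℂ ↦ Real.log (‖z - e‖ / R)) = fun z : ℂ ↦ Real.log ‖(fun w : ℂ ↦ (w - e) / (R : ℂ)) z‖ := by
    funext w
    simp [abs_of_pos hR]
  rw [e1]
  refine AnalyticAt.harmonicAt_log_norm (f := fun w : ℂ ↦ (w - e) / (R : ℂ)) ?_ ?_
  · exact (analyticAt_id.sub analyticAt_const).div analyticAt_const (by exact_mod_cast hR.ne')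
  · simp only [ne_eq, div_eq_zero_iff, sub_eq_zero, Complex.ofReal_eq_zero]
    push Not
    exact ⟨hze, hR.ne'⟩

/-- **Lindelöf's maximum principle** (Ransford 1995, Thm. 3.6.9 (b), the case of a bounded domain,
a harmonic function and a finite exceptional set). Let `U ⊆ ℂ` be open, preconnected and bounded,
`f` harmonic on `U` and bounded above there, `E` a finite set of points off `U`. If
`lim sup_{z → ζ, z ∈ U} f(z) ≤ M` at every boundary point `ζ ∉ E`, then `f ≤ M` on `U`.
[cite: Ransford1995, Thm. 3.6.9] -/
theorem harmonic_le_of_frontier_diff_finite {U : Set ℂ} (hUo : IsOpen U) (hUc : IsPreconnected U) (hUb : IsBounded U)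
    {E : Set ℂ} (hE : E.Finite) (hEU : ∀ e ∈ E, e ∉ U) {f : ℂ → ℝ} (hf : HarmonicOnNhd f U)
    {C : ℝ} (hC : ∀ z ∈ U, f z ≤ C) {M : ℝ}
    (hbdry : ∀ ζ ∈ frontier U, ζ ∉ E → ∀ ε : ℝ, 0 < ε → ∀ᶠ z in 𝓝[U] ζ, f z ≤ M + ε) :
    ∀ z ∈ U, f z ≤ M := by
  -- a radius exceeding all the distances `‖z - e‖`, `z ∈ U`, `e ∈ E`
  obtain ⟨r, hr⟩ := hUb.subset_closedBall 0
  obtain ⟨r', hr'⟩ := hE.isBounded.subset_closedBall 0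
  set R : ℝ := |r| + |r'| + 1 with hRdef
  have hR : 0 < R := by positivity
  have hdist : ∀ z ∈ U, ∀ e ∈ E, ‖z - e‖ < R := fun z hz e he ↦ by
    have h1 : ‖z‖ ≤ |r| := le_trans (mem_closedBall_zero_iff.1 (hr hz)) (le_abs_self r)
    have h2 : ‖e‖ ≤ |r'| := le_trans (mem_closedBall_zero_iff.1 (hr' he)) (le_abs_self r')
    calc ‖z - e‖ ≤ ‖z‖ + ‖e‖ := norm_sub_le z e
      _ < R := by rw [hRdef]; linarith
  -- induction on the exceptional set, for all `f` and `C` at once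
  suffices H : ∀ (E' : Set ℂ), E'.Finite → E' ⊆ E → ∀ (g : ℂ → ℝ), HarmonicOnNhd g U → ∀ (C' : ℝ), (∀ z ∈ U, g z ≤ C') →
      (∀ ζ ∈ frontier U, ζ ∉ E' → ∀ ε : ℝ, 0 < ε → ∀ᶠ z in 𝓝[U] ζ, g z ≤ M + ε) → ∀ z ∈ U, g z ≤ M from
    H E hE subset_rfl f hf C hC hbdry
  intro E' hE'
  induction E', hE' using Set.Finite.induction_on with
  | empty =>
    -- no exceptional point: the weak maximum principle
    intro _ g hg C' _ hgb
    exact harmonic_le_of_frontier_of_cocompact hUo hUc hg (fun ζ hζ ε hε ↦ hgb ζ hζ (fun h ↦ h) ε hε)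
      fun ε _ ↦ eventually_cocompact_inf_principal_of_isBounded hUb _
  | @insert e E₀ heE₀ hE₀ ih =>
    -- one more exceptional point `e`: logarithmic pole at `e`
    intro hsub g hg C' hC' hgb z₀ hz₀
    have heE : e ∈ E := hsub (mem_insert _ _)
    have hE₀E : E₀ ⊆ E := (subset_insert _ _).trans hsub
    have heU : e ∉ U := hEU e heE
    set L : ℂ → ℝ := fun z ↦ Real.log (‖z - e‖ / R) with hL
    have hLharm : HarmonicOnNhd L U := harmonicOnNhd_log_norm_sub_div heU hR
    have hLnonpos : ∀ z ∈ U, L z ≤ 0 := fun z hz ↦ by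
      refine Real.log_nonpos (by positivity) ?_
      rw [div_le_one hR]
      exact (hdist z hz e heE).le
    -- `g ≤ M - ε' L(z₀)` for every `ε' > 0`
    have key : ∀ ε' : ℝ, 0 < ε' → g z₀ ≤ M - ε' * L z₀ := by
      intro ε' hε'
      set g' : ℂ → ℝ := fun z ↦ g z + ε' * L z with hg'
      have hg'harm : HarmonicOnNhd g' U := by
        have h2 : HarmonicOnNhd (fun z ↦ ε' • L z) U := fun z hz ↦ (hLharm z hz).const_smul
        have e1 : g' = g + fun z ↦ ε' • L z := by funext z; simp [hg', smul_eq_mul]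
        rw [e1]
        exact hg.add h2
      have hg'le : ∀ z ∈ U, g' z ≤ g z := fun z hz ↦ by
        have := mul_nonpos_iff.2 (Or.inl ⟨hε'.le, hLnonpos z hz⟩)
        simp only [hg']; linarith
      have hg'C : ∀ z ∈ U, g' z ≤ C' := fun z hz ↦ (hg'le z hz).trans (hC' z hz)
      have hg'bdry : ∀ ζ ∈ frontier U, ζ ∉ E₀ → ∀ ε : ℝ, 0 < ε → ∀ᶠ z in 𝓝[U] ζ, g' z ≤ M + ε := by
        intro ζ hζ hζE₀ ε hε
        by_cases hζe : ζ = e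
        · -- at the pole: `g' → -∞`
          subst hζe
          set ρ₀ : ℝ := R * Real.exp ((M + ε - C') / ε') with hρ₀
          have hρ₀pos : 0 < ρ₀ := by positivity
          have hball : ∀ᶠ z in 𝓝[U] ζ, z ∈ ball ζ ρ₀ ∩ U :=
            Filter.inter_mem (mem_nhdsWithin_of_mem_nhds (ball_mem_nhds ζ hρ₀pos)) self_mem_nhdsWithin
          filter_upwards [hball] with z hz
          obtain ⟨hzb, hzU⟩ := hz
          have hze : z ≠ ζ := fun h ↦ heU (h ▸ hzU)
          have hnpos : 0 < ‖z - ζ‖ := norm_pos_iff.2 (sub_ne_zero.2 hze)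
          have hlt : ‖z - ζ‖ < ρ₀ := by rwa [mem_ball, dist_eq_norm] at hzb
          have hlog : L z ≤ (M + ε - C') / ε' := by
            simp only [hL]
            calc Real.log (‖z - ζ‖ / R) ≤ Real.log (ρ₀ / R) :=
                  Real.log_le_log (by positivity) (by gcongr)
              _ = (M + ε - C') / ε' := by
                  rw [hρ₀, mul_div_cancel_left₀ _ hR.ne', Real.log_exp]
          have h1 : ε' * L z ≤ M + ε - C' := by
            have := mul_le_mul_of_nonneg_left hlog hε'.le
            rwa [mul_div_cancel₀ _ hε'.ne'] at this
          simp only [hg']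
          linarith [hC' z hzU]
        · have hζE : ζ ∉ insert e E₀ := by
            rintro (h | h)
            · exact hζe h
            · exact hζE₀ h
          exact ((hgb ζ hζ hζE ε hε).and eventually_mem_nhdsWithin).mono
            fun z ⟨hz, hzU⟩ ↦ (hg'le z hzU).trans hz
      have := ih hE₀E g' hg'harm C' hg'C hg'bdry z₀ hz₀
      simp only [hg'] at this
      linarith
    -- let `ε' → 0`
    refine le_of_forall_pos_le_add fun δ hδ ↦ ?_
    have hε' : 0 < δ / (1 + |L z₀|) := by positivity
    have h := key _ hε'
    have hbound : -(δ / (1 + |L z₀|) * L z₀) ≤ δ := by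
      rw [← mul_neg]
      calc δ / (1 + |L z₀|) * -L z₀ ≤ δ / (1 + |L z₀|) * |L z₀| := by
            gcongr; exact neg_le_abs (L z₀)
        _ ≤ δ / (1 + |L z₀|) * (1 + |L z₀|) := by gcongr; linarith [abs_nonneg (L z₀)]
        _ = δ := div_mul_cancel₀ δ (by positivity)
    linarith

/-- **Lindelöf's minimum principle**: the symmetric statement for a harmonic function bounded
below. [cite: Ransford1995, Thm. 3.6.9] -/
theorem harmonic_ge_of_frontier_diff_finite {U : Set ℂ} (hUo : IsOpen U) (hUc : IsPreconnected U) (hUb : IsBounded U)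
    {E : Set ℂ} (hE : E.Finite) (hEU : ∀ e ∈ E, e ∉ U) {f : ℂ → ℝ} (hf : HarmonicOnNhd f U)
    {C : ℝ} (hC : ∀ z ∈ U, C ≤ f z) {M : ℝ}
    (hbdry : ∀ ζ ∈ frontier U, ζ ∉ E → ∀ ε : ℝ, 0 < ε → ∀ᶠ z in 𝓝[U] ζ, M - ε ≤ f z) :
    ∀ z ∈ U, M ≤ f z := by
  have h := harmonic_le_of_frontier_diff_finite hUo hUc hUb hE hEU hf.neg (C := -C)
    (fun z hz ↦ by simp only [Pi.neg_apply]; linarith [hC z hz]) (M := -M)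
    (fun ζ hζ hζE ε hε ↦ (hbdry ζ hζ hζE ε hε).mono fun z hz ↦ by simp only [Pi.neg_apply]; linarith)
  intro z hz
  have := h z hz
  simp only [Pi.neg_apply] at this
  linarith

/-- **Uniqueness with finitely many exceptional boundary points.** A bounded harmonic function on a
bounded preconnected open set which tends to `0` at every boundary point off a finite set `E`
(disjoint from the set) vanishes identically — e.g. the difference of two bounded harmonic
functions with the same boundary values away from finitely many jumps of the data (Smirnov 2010,
end of the proof of Lemma B.3). [cite: Ransford1995, Thm. 3.6.9] -/
theorem harmonic_eq_zero_of_tendsto_frontier_diff_finite {U : Set ℂ} (hUo : IsOpen U) (hUc : IsPreconnected U)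
    (hUb : IsBounded U) {E : Set ℂ} (hE : E.Finite) (hEU : ∀ e ∈ E, e ∉ U) {f : ℂ → ℝ} (hf : HarmonicOnNhd f U)
    {C : ℝ} (hC : ∀ z ∈ U, |f z| ≤ C)
    (hbdry : ∀ ζ ∈ frontier U, ζ ∉ E → Tendsto f (𝓝[U] ζ) (𝓝 0)) :
    ∀ z ∈ U, f z = 0 := by
  intro z hz
  refine le_antisymm ?_ ?_
  · refine harmonic_le_of_frontier_diff_finite hUo hUc hUb hE hEU hf (C := C) (fun w hw ↦ (le_abs_self _).trans (hC w hw))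
      (M := 0) (fun ζ hζ hζE ε hε ↦ ?_) z hz
    have := (hbdry ζ hζ hζE).eventually (Iio_mem_nhds (show (0 : ℝ) < 0 + ε by linarith))
    exact this.mono fun w hw ↦ le_of_lt hw
  · refine harmonic_ge_of_frontier_diff_finite hUo hUc hUb hE hEU hf (C := -C) (fun w hw ↦ (neg_le.1 ((neg_le_abs _).trans (hC w hw))))
      (M := 0) (fun ζ hζ hζE ε hε ↦ ?_) z hz
    have := (hbdry ζ hζ hζE).eventually (Ioi_mem_nhds (show (0 : ℝ) - ε < 0 by linarith))
    exact this.mono fun w hw ↦ le_of_lt hw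

end Literature.Analysis.Complex
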